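import Literature.Topology.FourManifolds.RegularIntervalLevels
import HarnessLib

/-!
# The regular interval theorem with a prescribed identity region

Topic `Literature/Topology/FourManifolds` (fact seat
`provefact-Literature.Topology.FourManifolds.lauden-f709dd520c`, Laudenbach–Poénaru's Lemma 2: a
handle slide is a self-diffeomorphism `Ψ = G⁻¹ ∘ Φ ∘ G` of the handlebody `M`, `Φ` the
handle-extension diffeomorphism of a sublevel set `{f ≤ c}` and `G : M ≅ {f ≤ c}` the push of
the regular interval theorem; to read the effect of `Ψ` on `π₁` one needs `Ψ = Φ` on the part of
`M` carrying the loops, i.e. `G = id` below a level `c - ζ` with `ζ` *prescribed*).  Everything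
here is **proved**; the two theorems are copies of
`exists_diffeomorph_image_sublevel_eq_of_isInteriorPoint'` (`RegularIntervalBoundary.lean`) and
`exists_diffeomorph_sublevel_apply_eq` (`RegularIntervalLevels.lean`) in which the auxiliary
width `δ` is additionally bounded by a prescribed `δ₀` and the identity region of the resulting
diffeomorphism is recorded; no named facts.

## References

* J. Milnor, *Morse theory* (1963), Thm. 3.1 and its proof. [Milnor1963]
* Y. Matsumoto, *An introduction to Morse theory* (2001), Thm. 3.1 (p. 79). [Matsumoto2001]
* J. Milnor, *Lectures on the h-cobordism theorem* (1965), Lemma 2.9, proof of Thm. 3.4.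
  [MilnorHCobordism1965]
-/

open scoped Manifold ContDiff Topology
open Set Function Filter

noncomputable section

namespace Literature.Topology.FourManifolds

/-! ### The ambient theorem with a bounded width -/

section Ambient

universe u

variable {E : Type u} [NormedAddCommGroup E] [NormedSpace ℝ E] [FiniteDimensional ℝ E]
  {H : Type*} [TopologicalSpace H] {I : ModelWithCorners ℝ E H}
  {M : Type*} [TopologicalSpace M] [ChartedSpace H M] [IsManifold I ∞ M]
  [T2Space M] [CompactSpace M]

/-- **Regular interval theorem, ambient form, with the width bounded by a prescribed `δ₀`**:
as `exists_diffeomorph_image_sublevel_eq_of_isInteriorPoint'` (`RegularIntervalBoundary.lean`,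
whose proof is repeated with `δ = min (min δ₁ δ₂) δ₀`), with moreover `δ ≤ δ₀`, so that the
identity region `{f ≤ a - 2δ} ∪ {b + 2δ ≤ f}` of `Φ` contains `{f ≤ a - 2δ₀} ∪ {b + 2δ₀ ≤ f}`.
[cite: Milnor1963, Thm. 3.1 and its proof] [cite: Matsumoto2001, Thm. 3.1 (p. 79)] -/
theorem exists_diffeomorph_image_sublevel_eq_of_isInteriorPoint_le
    {f : M → ℝ} (hf : ContMDiff I 𝓘(ℝ, ℝ) ∞ f) {a b : ℝ} (hab : a ≤ b)
    (hreg : ∀ x, f x ∈ Icc a b → mfderiv I 𝓘(ℝ, ℝ) f x ≠ 0)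
    (hint : ∀ x, f x ∈ Icc a b → I.IsInteriorPoint x) {δ₀ : ℝ} (hδ₀ : 0 < δ₀) :
    ∃ (δ : ℝ) (Φ : M ≃ₘ⟮I, I⟯ M), 0 < δ ∧ δ ≤ δ₀ ∧ Φ '' {x | f x ≤ a} = {x | f x ≤ b} ∧
      Φ '' (f ⁻¹' {a}) = f ⁻¹' {b} ∧ (∀ x, f x ≤ a - 2 * δ ∨ b + 2 * δ ≤ f x → Φ x = x) ∧
      (∀ x, f x ∈ Ioo (a - δ) (a + δ) → f (Φ x) = f x + (b - a)) ∧
      (∀ x, f x ≤ f (Φ x)) ∧ ∀ x, f (Φ x) ≤ f x + (b - a) := by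
  -- a unit-speed field across an enlarged slab of regular interior points
  obtain ⟨ξ, δ₁, hδ₁, hξ⟩ := exists_contMDiffSection_mlineDeriv_eq_one_slab hf hreg
  have hCc : IsClosed (I.boundary M) :=
    ModelWithCorners.isClosed_boundary (I := I) (M := M) (n := ∞) (by simp)
  obtain ⟨δ₂, hδ₂, hint₂⟩ := exists_pos_forall_mem_Icc_not_mem hf.continuous hCc
    (a := a) (b := b) fun x hx hxb => (I.isInteriorPoint_iff_not_isBoundaryPoint x).1 (hint x hx) hxb
  set δ : ℝ := min (min δ₁ δ₂) δ₀ with hδ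
  have hδpos : 0 < δ := lt_min (lt_min hδ₁ hδ₂) hδ₀
  have hδ₁' : δ ≤ δ₁ := (min_le_left _ _).trans (min_le_left _ _)
  have hδ₂' : δ ≤ δ₂ := (min_le_left _ _).trans (min_le_right _ _)
  have hδ₀' : δ ≤ δ₀ := min_le_right _ _
  have hunit : ∀ x, f x ∈ Icc (a - δ) (b + δ) → mlineDeriv I f x (ξ x) = 1 := fun x hx =>
    hξ x ⟨by linarith [hx.1], by linarith [hx.2]⟩
  have hint' : ∀ x, f x ∈ Icc (a - δ) (b + δ) → I.IsInteriorPoint x := fun x hx =>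
    (I.isInteriorPoint_iff_not_isBoundaryPoint x).2
      (hint₂ x ⟨by linarith [hx.1], by linarith [hx.2]⟩)
  -- the cut-off and the cut-off field
  set ψ : ℝ → ℝ := plateauCutoff (a - δ) (a - δ / 2) (b + δ / 2) (b + δ) with hψ
  have hl : a - δ < a - δ / 2 := by linarith
  have hu : b + δ / 2 < b + δ := by linarith
  have hψ0 : ∀ y, 0 ≤ ψ y := fun y => plateauCutoff_nonneg _ _ _ _ _
  have hψ1 : ∀ y, ψ y ≤ 1 := fun y => plateauCutoff_le_one _ _ _ _ _
  have hψone : ∀ y, y ∈ Icc (a - δ / 2) (b + δ / 2) → ψ y = 1 := fun y hy =>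
    plateauCutoff_eq_one hl hu hy
  have hψzero : ∀ y, y ∉ Ioo (a - δ) (b + δ) → ψ y = 0 := fun y hy =>
    plateauCutoff_eq_zero_of_not_mem hl hu hy
  set V : Π x : M, TangentSpace I x := fun x => ψ (f x) • ξ x with hV
  have hVs : ContMDiff I I.tangent ∞ fun x => (⟨x, V x⟩ : TangentBundle I M) :=
    ((contDiff_plateauCutoff _ _ _ _).comp_contMDiff hf).smul_section ξ.contMDiff
  have hVf : ∀ x, mlineDeriv I f x (V x) = ψ (f x) := by
    intro x
    simp only [hV, mlineDeriv_smul]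
    by_cases hx : f x ∈ Ioo (a - δ) (b + δ)
    · rw [hunit x ⟨hx.1.le, hx.2.le⟩, mul_one]
    · rw [hψzero _ hx, zero_mul]
  have hV0 : ∀ x, f x ∉ Ioo (a - δ) (b + δ) → V x = 0 := fun x hx => by
    simp only [hV, hψzero _ hx, zero_smul]
  -- it vanishes near the boundary: its flow is global
  have hfield : IsInteriorField I V := by
    refine ⟨hVs, fun x => ?_⟩
    by_cases hx : I.IsInteriorPoint x
    · exact Or.inl hx
    · right
      have hxb : f x ∉ Icc (a - δ) (b + δ) := fun h => hx (hint' x h)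
      have hopen : IsOpen {y : ℝ | y ∉ Icc (a - δ) (b + δ)} := isClosed_Icc.isOpen_compl
      filter_upwards [hf.continuous.continuousAt.preimage_mem_nhds (hopen.mem_nhds hxb)] with y hy
      exact hV0 y fun h => hy (Ioo_subset_Icc_self h)
  obtain ⟨θ, hθ⟩ := hfield.exists_isSmoothFlow
  -- `g p t = f (θ (t, p))` solves `g' = ψ (g)`
  set g : M → ℝ → ℝ := fun p t => f (θ (t, p)) with hg
  have hderiv : ∀ p t, HasDerivAt (g p) (ψ (g p t)) t := fun p t => by
    have h := hθ.hasDerivAt_comp (f := f) (hf.mdifferentiable (by simp)) p t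
    rw [hVf] at h
    exact h
  have hmono : ∀ p, Monotone (g p) := fun p => UnitSpeed.monotone_of_deriv_eq (hderiv p) hψ0
  have hband : ∀ p t, g p t ∈ Ioo (a - δ / 2) (b + δ / 2) → ψ (g p t) = 1 := fun p t ht =>
    hψone _ ⟨ht.1.le, ht.2.le⟩
  have hg0 : ∀ p, g p 0 = f p := fun p => by simp [hg, hθ.map_zero]
  set T₀ : ℝ := b - a with hT₀
  have hT₀0 : 0 ≤ T₀ := by rw [hT₀]; linarith
  -- unit speed from time `0` for a time `T` with `a - δ/2 < f p`, `f p + T < b + δ/2`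
  have hspeed : ∀ p T, a - δ / 2 < f p → f p + T < b + δ / 2 → 0 ≤ T → g p T = f p + T := by
    intro p T h1 h2 hT
    have key := UnitSpeed.eq_add_of_deriv_eq_one (g := g p) (g' := fun t => ψ (g p t))
      (hderiv p) (hband p) (t₀ := 0) (T := T) (by rw [hg0]; exact h1) (by rw [hg0]; exact h2)
      T ⟨hT, le_rfl⟩
    rw [zero_add, hg0] at key
    exact key
  refine ⟨δ / 2, GlobalFlow.diffeomorph hθ.contMDiff hθ.map_zero hθ.map_add T₀, by positivity, by linarith,
    ?_, ?_, ?_, ?_, ?_, ?_⟩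
  · -- sublevel sets
    ext q
    simp only [mem_image, mem_setOf_eq, GlobalFlow.diffeomorph_apply]
    constructor
    · -- (A) `f p ≤ a ⇒ f (θ (T₀, p)) ≤ b`: speed at most `1`
      rintro ⟨p, hp, rfl⟩
      have h := UnitSpeed.le_add_of_deriv_eq (hderiv p) hψ1 0 hT₀0
      rw [zero_add, hg0] at h
      change g p T₀ ≤ b
      linarith
    · -- (B) `f q ≤ b ⇒ q = θ (T₀, p)` with `f p ≤ a`, where `p = θ (-T₀, q)`
      intro hq
      refine ⟨θ (-T₀, q), ?_, GlobalFlow.apply_apply_neg hθ.map_zero hθ.map_add T₀ q⟩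
      set p := θ (-T₀, q) with hp
      have hpq : g p T₀ = f q := by
        simp only [hg]
        rw [GlobalFlow.apply_apply_neg hθ.map_zero hθ.map_add T₀ q]
      by_contra hgt
      rw [not_le] at hgt
      rcases le_or_gt (b + δ / 4) (f p) with h1 | h1
      · -- far above: monotone
        have := hmono p hT₀0
        rw [hg0, hpq] at this
        linarith
      · rcases lt_or_ge (f p + T₀) (b + δ / 2) with h2 | h2
        · -- unit speed all the way
          have := hspeed p T₀ (by linarith) h2 hT₀0
          rw [hpq] at this
          linarith
        · -- unit speed up to the level `b + δ/4`, then monotone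
          set T : ℝ := b + δ / 4 - f p with hT
          have hT0 : 0 ≤ T := by rw [hT]; linarith
          have hTT₀ : T ≤ T₀ := by rw [hT]; linarith
          have h3 := hspeed p T (by linarith) (by rw [hT]; linarith) hT0
          have h4 := hmono p hTT₀
          rw [h3, hpq] at h4
          linarith
  · -- level sets
    ext q
    simp only [mem_image, mem_preimage, mem_singleton_iff, GlobalFlow.diffeomorph_apply]
    constructor
    · -- (C) `f p = a ⇒ f (θ (T₀, p)) = b`
      rintro ⟨p, hp, rfl⟩
      have := hspeed p T₀ (by rw [hp]; linarith) (by rw [hp]; linarith) hT₀0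
      change g p T₀ = b
      rw [this, hp, hT₀]
      ring
    · -- (D) `f q = b ⇒ q = θ (T₀, p)` with `f p = a`
      intro hq
      refine ⟨θ (-T₀, q), ?_, GlobalFlow.apply_apply_neg hθ.map_zero hθ.map_add T₀ q⟩
      set p := θ (-T₀, q) with hp
      have hpq : g p T₀ = f q := by
        simp only [hg]
        rw [GlobalFlow.apply_apply_neg hθ.map_zero hθ.map_add T₀ q]
      refine le_antisymm ?_ ?_
      · -- `f p ≤ a`, as in (B)
        by_contra hgt
        rw [not_le] at hgt
        rcases le_or_gt (b + δ / 4) (f p) with h1 | h1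
        · have := hmono p hT₀0
          rw [hg0, hpq] at this
          linarith
        · rcases lt_or_ge (f p + T₀) (b + δ / 2) with h2 | h2
          · have := hspeed p T₀ (by linarith) h2 hT₀0
            rw [hpq] at this
            linarith
          · set T : ℝ := b + δ / 4 - f p with hT
            have hT0 : 0 ≤ T := by rw [hT]; linarith
            have hTT₀ : T ≤ T₀ := by rw [hT]; linarith
            have h3 := hspeed p T (by linarith) (by rw [hT]; linarith) hT0
            have h4 := hmono p hTT₀
            rw [h3, hpq] at h4
            linarith
      · -- `a ≤ f p`: speed at most `1`
        have h := UnitSpeed.le_add_of_deriv_eq (hderiv p) hψ1 0 hT₀0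
        rw [zero_add, hg0, hpq, hq] at h
        linarith
  · -- identity off the enlarged band
    intro x hx
    have hx' : f x ∉ Ioo (a - δ) (b + δ) := fun h => by
      rcases hx with hx | hx
      · linarith [h.1]
      · linarith [h.2]
    exact hθ.apply_eq_self_of_apply_eq_zero (hVs.of_le (by norm_cast)) (hV0 x hx') T₀
  · -- the level identity near `f⁻¹(a)`
    intro x hx
    show g x T₀ = f x + (b - a)
    exact hspeed x T₀ (by linarith [hx.1]) (by rw [hT₀]; linarith [hx.2]) hT₀0
  · -- `f` does not decrease
    intro x
    have h := hmono x hT₀0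
    rw [hg0] at h
    exact h
  · -- speed at most `1`
    intro x
    have h := UnitSpeed.le_add_of_deriv_eq (hderiv x) hψ1 0 hT₀0
    rw [zero_add, hg0] at h
    exact h

end Ambient

/-! ### `M ≅ Mᶜ` with a prescribed profile and identity region -/

section Levels

universe u

variable {k : ℕ} {M : Type u} [TopologicalSpace M] [T2Space M] [CompactSpace M]
  [ChartedSpace (EuclideanHalfSpace (k + 1)) M] [IsManifold (𝓡∂ (k + 1)) ∞ M]

/-- **The regular interval theorem with a prescribed profile and a prescribed identity region.**  In the situation of
`Literature.Topology.FourManifolds.nonempty_diffeomorph_sublevel_of_forall_le_mfderiv_ne_zero`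
(`f` smooth on the compact manifold with boundary `M` of dimension `k + 1 ≥ 2`, `f = 1` on `∂M`,
`f < 1` inside, `df ≠ 0` wherever `c ≤ f`, `c < 1`) there is `a_max > 0` such that for every
height `a₀ ∈ (0, a_max]` there are a diffeomorphism `G : M ≅ Mᶜ` and `s₀ > 0` with
`f (G x) = c + κ(a₀) - σ_{a₀}(1 - f x)` whenever `1 - f x < s₀` — the levels near `∂M` are moved
by a map depending only on `(c, a₀)` (`G = Φ⁻¹ ∘ push` for a cover of height exactly `a₀`;
the push sends depth `s` to depth `σ_{a₀}(s)` and `Φ⁻¹` lowers `f` by `(1 - κ(a₀)) - c`); moreover, for any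
prescribed `ζ > 0`, `G` is the identity on `{f ≤ c - ζ}` (the push is the identity below depth
`a₀/2 ≤ (1 - c)/2`, and `Φ` is the identity below `c - 2δ` with `δ ≤ ζ/2`).  Copy of
`exists_diffeomorph_sublevel_apply_eq` (`RegularIntervalLevels.lean`) with the identity region recorded.
[cite: Milnor1963, Thm. 3.1] [cite: MilnorHCobordism1965, Lemma 2.9 and proof of Thm. 3.4] -/
theorem exists_diffeomorph_sublevel_apply_eq_eq_self (hk : 1 ≤ k) {f : M → ℝ}
    (hf : ContMDiff (𝓡∂ (k + 1)) 𝓘(ℝ, ℝ) ∞ f)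
    (hbd : ∀ x ∈ (𝓡∂ (k + 1)).boundary M, f x = 1)
    (hlt : ∀ x ∈ (𝓡∂ (k + 1)).interior M, f x < 1) {c : ℝ} (hc : c < 1)
    (hreg : ∀ x, c ≤ f x → mfderiv (𝓡∂ (k + 1)) 𝓘(ℝ, ℝ) f x ≠ 0)
    (hint : ∀ p, f p ≤ c → (𝓡∂ (k + 1)).IsInteriorPoint p)
    (hreg' : ∀ p, f p = c → ¬ IsMCriticalPt (𝓡∂ (k + 1)) f p) {ζ : ℝ} (hζ : 0 < ζ) :
    letI := (sublevelAtlas hf c hint hreg').chartedSpace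
    ∃ amax : ℝ, 0 < amax ∧ ∀ a₀ : ℝ, 0 < a₀ → a₀ ≤ amax →
      ∃ (G : M ≃ₘ⟮𝓡∂ (k + 1), 𝓡∂ (k + 1)⟯ ↥(f ⁻¹' Iic c)) (s₀ : ℝ), 0 < s₀ ∧
        (∀ x, 1 - f x < s₀ → f (G x).1 = c + pushDepthOf a₀ - pushShiftOf a₀ (1 - f x)) ∧
        ∀ x, f x ≤ c - ζ → (G x).1 = x := by
  set A := sublevelAtlas hf c hint hreg' with hA
  letI := A.chartedSpace
  haveI := A.isManifold
  obtain ⟨D, hDf, hDδ⟩ := exists_flowoutInput_of_boundary hf hbd hlt hc hreg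
  obtain ⟨Γ₀⟩ := D.nonempty_cover
  have hfD : ∀ z, D.f z = 1 - f z := fun z => by rw [hDf]
  refine ⟨min Γ₀.a (1 - c), lt_min Γ₀.a_pos (by linarith), fun a₀ ha₀ ha₀le => ?_⟩
  set Γ := Γ₀.withHeight a₀ ha₀ (ha₀le.trans (min_le_left _ _)) with hΓ
  have hΓa : Γ.a = a₀ := rfl
  set κ := Γ.pushDepth with hκ
  have hκeq : κ = pushDepthOf a₀ := rfl
  have hσeq : ∀ s, Γ.pushShift s = pushShiftOf a₀ s := fun s => rfl
  have hκpos : 0 < κ := Γ.pushDepth_pos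
  have hκle : κ < 1 - c := by
    have h1 : κ ≤ a₀ / 2 := pushDepthOf_le ha₀.le
    have h3 : a₀ ≤ 1 - c := ha₀le.trans (min_le_right _ _)
    linarith
  have hrange : range Γ.push = {w | f w ≤ 1 - κ} := by
    rw [Γ.range_push]
    ext w
    simp only [mem_setOf_eq, hfD]
    constructor <;> intro h <;> linarith
  -- the ambient diffeomorphism, with its level bookkeeping
  have hcb : c ≤ 1 - κ := by linarith
  have hregs : ∀ x, f x ∈ Icc c (1 - κ) → mfderiv (𝓡∂ (k + 1)) 𝓘(ℝ, ℝ) f x ≠ 0 :=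
    fun x hx => hreg x hx.1
  have hints : ∀ x, f x ∈ Icc c (1 - κ) → (𝓡∂ (k + 1)).IsInteriorPoint x := fun x hx =>
    ((𝓡∂ (k + 1)).isInteriorPoint_or_isBoundaryPoint x).resolve_right fun hb => by
      have := hbd x hb; linarith [hx.2]
  obtain ⟨δ, Φ, hδ, hδζ, hΦ, -, hΦid, hlevel, -, hle⟩ :=
    exists_diffeomorph_image_sublevel_eq_of_isInteriorPoint_le hf hcb hregs hints (half_pos hζ)
  have hmem : ∀ z, Φ.symm (Γ.push z) ∈ f ⁻¹' Iic c := by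
    intro z
    have h1 : Γ.push z ∈ Φ '' {x | f x ≤ c} := by
      rw [hΦ, ← hrange]; exact mem_range_self z
    obtain ⟨x, hx, hxe⟩ := h1
    rw [← hxe, Diffeomorph.symm_apply_apply]
    exact hx
  have hmem' : ∀ w : ↥(f ⁻¹' Iic c), Φ w.1 ∈ {w | Γ.pushDepth ≤ D.f w} := by
    intro w
    have h1 : Φ w.1 ∈ Φ '' {x | f x ≤ c} := mem_image_of_mem _ w.2
    rw [hΦ] at h1
    show Γ.pushDepth ≤ D.f (Φ w.1)
    rw [hfD]
    simp only [mem_setOf_eq] at h1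
    linarith
  have hto : ContMDiff (𝓡∂ (k + 1)) (𝓡∂ (k + 1)) ∞
      ((f ⁻¹' Iic c).codRestrict (fun z => Φ.symm (Γ.push z)) hmem) :=
    A.contMDiff_codRestrict hmem (Φ.symm.contMDiff.comp Γ.contMDiff_push)
  have hinv : ContMDiff (𝓡∂ (k + 1)) (𝓡∂ (k + 1)) ∞
      (fun w : ↥(f ⁻¹' Iic c) => Γ.pull (Φ w.1)) :=
    Γ.contMDiffOn_pull.comp_contMDiff (Φ.contMDiff.comp (A.contMDiff_subtype_val hk)) hmem'
  set G : M ≃ₘ⟮𝓡∂ (k + 1), 𝓡∂ (k + 1)⟯ ↥(f ⁻¹' Iic c) :=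
    { toFun := (f ⁻¹' Iic c).codRestrict (fun z => Φ.symm (Γ.push z)) hmem
      invFun := fun w => Γ.pull (Φ w.1)
      left_inv := fun z => by
        show Γ.pull (Φ (Φ.symm (Γ.push z))) = z
        rw [Diffeomorph.apply_symm_apply, Γ.pull_push]
      right_inv := fun w => by
        apply Subtype.ext
        show Φ.symm (Γ.push (Γ.pull (Φ w.1))) = w.1
        rw [Γ.push_pull (hmem' w), Diffeomorph.symm_apply_apply]
      contMDiff_toFun := hto
      contMDiff_invFun := hinv } with hG
  refine ⟨G, δ, hδ, fun x hx => ?_, fun x hx => ?_⟩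
  swap
  · -- the identity region: the push and `Φ` are the identity there
    show Φ.symm (Γ.push x) = x
    have hdepth : Γ.pushLen ≤ D.f x := by
      rw [hfD]
      show Γ.a / 2 ≤ 1 - f x
      rw [hΓa]
      have h3 : a₀ ≤ 1 - c := ha₀le.trans (min_le_right _ _)
      linarith
    rw [Γ.push_of_pushLen_le hdepth]
    have hΦx : Φ x = x := hΦid x (Or.inl (by linarith))
    conv_lhs => rw [← hΦx]
    exact Φ.symm_apply_apply x
  -- the level of `G x = Φ⁻¹ (push x)`
  show f (Φ.symm (Γ.push x)) = c + pushDepthOf a₀ - pushShiftOf a₀ (1 - f x)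
  set s := 1 - f x with hs
  set y := Φ.symm (Γ.push x) with hy
  have hpush : f (Γ.push x) = 1 - Γ.pushShift s := by
    have h := Γ.f_push x
    rw [hfD, hfD] at h
    linarith
  have hΦy : Φ y = Γ.push x := by rw [hy, Diffeomorph.apply_symm_apply]
  have hσle : Γ.pushShift s ≤ s + κ := Γ.pushShift_le s
  have hyc : f y ≤ c := hmem x
  -- speed at most one: `f (push x) ≤ f y + ((1 - κ) - c)`
  have hlow : c + κ - Γ.pushShift s ≤ f y := by
    have h := hle y
    rw [hΦy, hpush] at h
    linarith
  have hband : f y ∈ Ioo (c - δ) (c + δ) := ⟨by linarith, by linarith⟩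
  have h := hlevel y hband
  rw [hΦy, hpush] at h
  rw [← hκeq, ← hσeq]
  linarith

end Levels

end Literature.Topology.FourManifolds
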